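import Literature.InformationTheory.QuantumCodes.HypergraphProduct
import HarnessLib

/-!
# Row and column weights of the hypergraph-product check matrices (Tillich–Zémor 2014, §4 and §6 Remark)

Tillich–Zémor, *Quantum LDPC codes with positive rate and minimum distance proportional to n^{1/2}*, IEEE TIT 60
(2014) = arXiv:0903.0566, §4 ("Row and column weights of `H_X` and `H_Z`") and the Remark of §6: for the product
`ℋ₁·ℋ₂` the row of `H_X` indexed by the vertex `(a,b)` has weight (row weight of `a` in `H₁`) + (row weight of `b`
in `H₂`), the row of `H_Z` indexed by the chamber `(α,β)` has weight (column weight of `α` in `H₁`) + (column weight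
of `β` in `H₂`), and the columns of `H_X`, `H_Z` have the weights of single columns/rows of `H₁`, `H₂` — "the quantum
code has a parity-check matrix with row weights of the form `i+j`, where `i` and `j` are respectively row and column
weights of the original parity check matrix" (Theorem 1). This file PROVES these weight statements as INEQUALITIES
(`≤`, which is what LDPC-ness needs) for the tree's `HypergraphProduct.xMatrix H₁ H₂ = [H₁ ⊗ 1 | 1 ⊗ H₂]` and
`HypergraphProduct.zMatrix H₁ H₂ = [1 ⊗ H₂ᵀ | H₁ᵀ ⊗ 1]` (`QuantumCodes/HypergraphProduct.lean`), for arbitrary binary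
matrices `H₁ : V₁ × E₁`, `H₂ : V₂ × E₂`:

* `hammingNorm_xMatrix_row_le`     : `wt (H_X row (a,b)) ≤ wt (H₁ row a) + wt (H₂ row b)`;
* `hammingNorm_xMatrix_col_inl_le` : `wt (H_X column αb') ≤ wt (H₁ column α)`;
* `hammingNorm_xMatrix_col_inr_le` : `wt (H_X column a'β) ≤ wt (H₂ column β)`;
* `hammingNorm_zMatrix_row_le`     : `wt (H_Z row (α,β)) ≤ wt (H₁ column α) + wt (H₂ column β)`;
* `hammingNorm_zMatrix_col_inl_le` : `wt (H_Z column α'b) ≤ wt (H₂ row b)`;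
* `hammingNorm_zMatrix_col_inr_le` : `wt (H_Z column aβ') ≤ wt (H₁ row a)`.

So if every row and column of `H₁`, `H₂` has weight `≤ w` then `H_X`, `H_Z` are `2w`-limited (used by
`GoodQLDPCFromHypergraphProduct.lean` to discharge the asymptotic Tillich–Zémor fact of `GoodQLDPC.lean`).
-/

namespace Literature.InformationTheory.QuantumCodes

namespace HypergraphProduct

open Matrix Finset

variable {V₁ E₁ V₂ E₂ : Type*} [Fintype V₁] [Fintype E₁] [Fintype V₂] [Fintype E₂]
variable [DecidableEq V₁] [DecidableEq E₁] [DecidableEq V₂] [DecidableEq E₂]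

/-- Weight bound from a support enclosure: if every non-zero coordinate of `f` lies in `s` then `wt f ≤ |s|`.
[cite: TillichZemor2014, §4 (arXiv:0903.0566v1 chunk p0007 L25-45: counting the non-zero entries of a row/column)] -/
theorem hammingNorm_le_card_of_subset {ι : Type*} [Fintype ι] {R : Type*} [Zero R] [DecidableEq R]
    (f : ι → R) (s : Finset ι) (h : ∀ x, f x ≠ 0 → x ∈ s) : hammingNorm f ≤ s.card := by
  classical
  unfold hammingNorm
  exact Finset.card_le_card fun x hx => h x (Finset.mem_filter.1 hx).2

/-- The weight of a vector indexed by a sum type splits over the two summands.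
[cite: TillichZemor2014, §4 (arXiv:0903.0566v1 chunk p0007 L25-45: the two blocks `E_R`, `E_L` of the edge set)] -/
theorem hammingNorm_sum_type {α β : Type*} [Fintype α] [Fintype β] {R : Type*} [Zero R] [DecidableEq R]
    (f : α ⊕ β → R) : hammingNorm f = hammingNorm (fun a => f (Sum.inl a)) + hammingNorm (fun b => f (Sum.inr b)) := by
  classical
  simp only [hammingNorm, Finset.card_filter]
  rw [Fintype.sum_sum_type]

/-- **Row weights of `H_X`** (TZ §4): the row of `H_X = [H₁ ⊗ 1 | 1 ⊗ H₂]` at the vertex `(a,b)` has weight at most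
(weight of row `a` of `H₁`) + (weight of row `b` of `H₂`).
[cite: TillichZemor2014, §4 (arXiv:0903.0566v1 chunk p0007 L25-45) and Thm 1 ("row weights of the form `i+j`")] -/
theorem hammingNorm_xMatrix_row_le (H₁ : Matrix V₁ E₁ (ZMod 2)) (H₂ : Matrix V₂ E₂ (ZMod 2)) (a : V₁) (b : V₂) :
    hammingNorm (xMatrix H₁ H₂ (a, b)) ≤ hammingNorm (H₁ a) + hammingNorm (H₂ b) := by
  classical
  rw [hammingNorm_sum_type]
  refine add_le_add ?_ ?_
  · calc hammingNorm (fun s : E₁ × V₂ => xMatrix H₁ H₂ (a, b) (Sum.inl s))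
        ≤ ((univ.filter fun α => H₁ a α ≠ 0).image fun α => (α, b)).card :=
          hammingNorm_le_card_of_subset _ _ fun s hs => by
            obtain ⟨α, b'⟩ := s
            rw [xMatrix_apply_inl] at hs
            have hb : b = b' := by by_contra h; exact hs (by simp [h])
            have hα : H₁ a α ≠ 0 := fun h => hs (by simp [h])
            exact Finset.mem_image.2 ⟨α, Finset.mem_filter.2 ⟨Finset.mem_univ _, hα⟩, by rw [hb]⟩
      _ ≤ hammingNorm (H₁ a) := Finset.card_image_le
  · calc hammingNorm (fun s : V₁ × E₂ => xMatrix H₁ H₂ (a, b) (Sum.inr s))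
        ≤ ((univ.filter fun β => H₂ b β ≠ 0).image fun β => (a, β)).card :=
          hammingNorm_le_card_of_subset _ _ fun s hs => by
            obtain ⟨a', β⟩ := s
            rw [xMatrix_apply_inr] at hs
            have ha : a = a' := by by_contra h; exact hs (by simp [h])
            have hβ : H₂ b β ≠ 0 := fun h => hs (by simp [h])
            exact Finset.mem_image.2 ⟨β, Finset.mem_filter.2 ⟨Finset.mem_univ _, hβ⟩, by rw [ha]⟩
      _ ≤ hammingNorm (H₂ b) := Finset.card_image_le

omit [Fintype E₁] [Fintype E₂] [DecidableEq E₁] [DecidableEq E₂] in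
/-- **Column weights of `H_X`, edges of type `E_R`**: the column of `H_X` at `αb'` has weight at most the weight of
column `α` of `H₁`. [cite: TillichZemor2014, §4 (arXiv:0903.0566v1 chunk p0007 L25-45)] -/
theorem hammingNorm_xMatrix_col_inl_le (H₁ : Matrix V₁ E₁ (ZMod 2)) (H₂ : Matrix V₂ E₂ (ZMod 2)) (α : E₁) (b' : V₂) :
    hammingNorm (fun v : V₁ × V₂ => xMatrix H₁ H₂ v (Sum.inl (α, b'))) ≤ hammingNorm (fun a => H₁ a α) := by
  classical
  calc hammingNorm (fun v : V₁ × V₂ => xMatrix H₁ H₂ v (Sum.inl (α, b')))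
      ≤ ((univ.filter fun a => H₁ a α ≠ 0).image fun a => (a, b')).card :=
        hammingNorm_le_card_of_subset _ _ fun v hv => by
          obtain ⟨a, b⟩ := v
          have hv' : H₁ a α * (if b = b' then 1 else 0) ≠ 0 := by rwa [xMatrix_apply_inl] at hv
          have hb : b = b' := by by_contra h; exact hv' (by simp [h])
          have ha : H₁ a α ≠ 0 := fun h => hv' (by simp [h])
          exact Finset.mem_image.2 ⟨a, Finset.mem_filter.2 ⟨Finset.mem_univ _, ha⟩, by rw [hb]⟩
    _ ≤ hammingNorm (fun a => H₁ a α) := Finset.card_image_le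

omit [Fintype E₁] [Fintype E₂] [DecidableEq E₁] [DecidableEq E₂] in
/-- **Column weights of `H_X`, edges of type `E_L`**: the column of `H_X` at `a'β` has weight at most the weight of
column `β` of `H₂`. [cite: TillichZemor2014, §4 (arXiv:0903.0566v1 chunk p0007 L25-45)] -/
theorem hammingNorm_xMatrix_col_inr_le (H₁ : Matrix V₁ E₁ (ZMod 2)) (H₂ : Matrix V₂ E₂ (ZMod 2)) (a' : V₁) (β : E₂) :
    hammingNorm (fun v : V₁ × V₂ => xMatrix H₁ H₂ v (Sum.inr (a', β))) ≤ hammingNorm (fun b => H₂ b β) := by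
  classical
  calc hammingNorm (fun v : V₁ × V₂ => xMatrix H₁ H₂ v (Sum.inr (a', β)))
      ≤ ((univ.filter fun b => H₂ b β ≠ 0).image fun b => (a', b)).card :=
        hammingNorm_le_card_of_subset _ _ fun v hv => by
          obtain ⟨a, b⟩ := v
          have hv' : (if a = a' then 1 else 0) * H₂ b β ≠ 0 := by rwa [xMatrix_apply_inr] at hv
          have ha : a = a' := by by_contra h; exact hv' (by simp [h])
          have hb : H₂ b β ≠ 0 := fun h => hv' (by simp [h])
          exact Finset.mem_image.2 ⟨b, Finset.mem_filter.2 ⟨Finset.mem_univ _, hb⟩, by rw [ha]⟩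
    _ ≤ hammingNorm (fun b => H₂ b β) := Finset.card_image_le

/-- **Row weights of `H_Z`** (TZ §4: a chamber `C_{αβ}` has `|α| + |β|` edges): the row of `H_Z = [1 ⊗ H₂ᵀ | H₁ᵀ ⊗ 1]`
at `(α,β)` has weight at most (weight of column `α` of `H₁`) + (weight of column `β` of `H₂`).
[cite: TillichZemor2014, §3-§4 (arXiv:0903.0566v1 chunk p0006 L82-90: `|C_{αβ}| = |α| + |β|`; chunk p0007 L25-45)] -/
theorem hammingNorm_zMatrix_row_le (H₁ : Matrix V₁ E₁ (ZMod 2)) (H₂ : Matrix V₂ E₂ (ZMod 2)) (α : E₁) (β : E₂) :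
    hammingNorm (zMatrix H₁ H₂ (α, β)) ≤ hammingNorm (fun a => H₁ a α) + hammingNorm (fun b => H₂ b β) := by
  classical
  rw [hammingNorm_sum_type, add_comm]
  refine add_le_add ?_ ?_
  · calc hammingNorm (fun s : V₁ × E₂ => zMatrix H₁ H₂ (α, β) (Sum.inr s))
        ≤ ((univ.filter fun a => H₁ a α ≠ 0).image fun a => (a, β)).card :=
          hammingNorm_le_card_of_subset _ _ fun s hs => by
            obtain ⟨a, β'⟩ := s
            rw [zMatrix_apply_inr] at hs
            have hb : β = β' := by by_contra h; exact hs (by simp [h])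
            have ha : H₁ a α ≠ 0 := fun h => hs (by simp [h])
            exact Finset.mem_image.2 ⟨a, Finset.mem_filter.2 ⟨Finset.mem_univ _, ha⟩, by rw [hb]⟩
      _ ≤ hammingNorm (fun a => H₁ a α) := Finset.card_image_le
  · calc hammingNorm (fun s : E₁ × V₂ => zMatrix H₁ H₂ (α, β) (Sum.inl s))
        ≤ ((univ.filter fun b => H₂ b β ≠ 0).image fun b => (α, b)).card :=
          hammingNorm_le_card_of_subset _ _ fun s hs => by
            obtain ⟨α', b⟩ := s
            rw [zMatrix_apply_inl] at hs
            have ha : α = α' := by by_contra h; exact hs (by simp [h])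
            have hb : H₂ b β ≠ 0 := fun h => hs (by simp [h])
            exact Finset.mem_image.2 ⟨b, Finset.mem_filter.2 ⟨Finset.mem_univ _, hb⟩, by rw [ha]⟩
      _ ≤ hammingNorm (fun b => H₂ b β) := Finset.card_image_le

omit [Fintype V₁] [Fintype V₂] [DecidableEq V₁] [DecidableEq V₂] in
/-- **Column weights of `H_Z`, edges of type `E_R`**: the column of `H_Z` at `α'b` has weight at most the weight of
row `b` of `H₂`. [cite: TillichZemor2014, §4 (arXiv:0903.0566v1 chunk p0007 L25-45)] -/
theorem hammingNorm_zMatrix_col_inl_le (H₁ : Matrix V₁ E₁ (ZMod 2)) (H₂ : Matrix V₂ E₂ (ZMod 2)) (α' : E₁) (b : V₂) :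
    hammingNorm (fun c : E₁ × E₂ => zMatrix H₁ H₂ c (Sum.inl (α', b))) ≤ hammingNorm (H₂ b) := by
  classical
  calc hammingNorm (fun c : E₁ × E₂ => zMatrix H₁ H₂ c (Sum.inl (α', b)))
      ≤ ((univ.filter fun β => H₂ b β ≠ 0).image fun β => (α', β)).card :=
        hammingNorm_le_card_of_subset _ _ fun c hc => by
          obtain ⟨α, β⟩ := c
          have hc' : (if α = α' then 1 else 0) * H₂ b β ≠ 0 := by rwa [zMatrix_apply_inl] at hc
          have ha : α = α' := by by_contra h; exact hc' (by simp [h])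
          have hb : H₂ b β ≠ 0 := fun h => hc' (by simp [h])
          exact Finset.mem_image.2 ⟨β, Finset.mem_filter.2 ⟨Finset.mem_univ _, hb⟩, by rw [ha]⟩
    _ ≤ hammingNorm (H₂ b) := Finset.card_image_le

omit [Fintype V₁] [Fintype V₂] [DecidableEq V₁] [DecidableEq V₂] in
/-- **Column weights of `H_Z`, edges of type `E_L`**: the column of `H_Z` at `aβ'` has weight at most the weight of
row `a` of `H₁`. [cite: TillichZemor2014, §4 (arXiv:0903.0566v1 chunk p0007 L25-45)] -/
theorem hammingNorm_zMatrix_col_inr_le (H₁ : Matrix V₁ E₁ (ZMod 2)) (H₂ : Matrix V₂ E₂ (ZMod 2)) (a : V₁) (β' : E₂) :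
    hammingNorm (fun c : E₁ × E₂ => zMatrix H₁ H₂ c (Sum.inr (a, β'))) ≤ hammingNorm (H₁ a) := by
  classical
  calc hammingNorm (fun c : E₁ × E₂ => zMatrix H₁ H₂ c (Sum.inr (a, β')))
      ≤ ((univ.filter fun α => H₁ a α ≠ 0).image fun α => (α, β')).card :=
        hammingNorm_le_card_of_subset _ _ fun c hc => by
          obtain ⟨α, β⟩ := c
          have hc' : H₁ a α * (if β = β' then 1 else 0) ≠ 0 := by rwa [zMatrix_apply_inr] at hc
          have hb : β = β' := by by_contra h; exact hc' (by simp [h])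
          have ha : H₁ a α ≠ 0 := fun h => hc' (by simp [h])
          exact Finset.mem_image.2 ⟨α, Finset.mem_filter.2 ⟨Finset.mem_univ _, ha⟩, by rw [hb]⟩
    _ ≤ hammingNorm (H₁ a) := Finset.card_image_le

end HypergraphProduct

end Literature.InformationTheory.QuantumCodes
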